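import Summits.AtomisticToContinuum.Crystallization.Theorems.ChargedEnergyGapOctahedralLedgerE
import HarnessLib

/-!
(SPLIT FOR THE 400-LINE CAP by the landing lane, hand-2 g36: this file = part 1 of 3; sequels `…ChargedEnergyGapEdgeSpaceDeficitB`, `…ChargedEnergyGapEdgeSpaceDeficit` import it in a chain; same namespace, all FQNs unchanged.)
# ChargedEnergyGap · NODE 74 «EdgeSpaceDeficit» (lens-3 g74): the onset crux (K₁ᴴ) through the FIELD-FREE octahedral deficit ledger

Cell `decomp-a2c`, lens 3 («one certified translation + a split beneath»), generation 74.  Line of record UNCHANGED: (N-q) at `b₁ = 3/10` ∧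
[MID-qᶠ]; after NODE 73 «OctahedralLedger» (parts A–E, (G) (K₀) (C) proved) the residual beneath [MID-qᶠ] is (L) `OctLedgerQ` [bookkeeping, TRUE]
∧ **(K₁ᴴ) `OctShellHQ`** — a GLOBAL inequality for the weighted harmonic truss over the clean non-plateau ("shell") octahedra, quantified over the
thirteen-hypothesis q-block INCLUDING the rotation cocycle `β₀`, the seam system `S` and the Volterra field.

## The translation (the ONE allowed EQUIV-type move of this lens, CERTIFIED here)

On a clean framed octahedron the Volterra field is a coboundary `β = δu` (local exactness, landed `volterraField_localExact_of_diam`) and `u` is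
`τ`-Lipschitz on the six vertices (the `SmallStrain` binder).  NOTHING ELSE of `β₀, S, k` survives at the octahedron.  Hence the octahedron form is
bounded below by minus the **LIPSCHITZ-BOX DEFICIT**
  `octDeficit κ₂ r₁ τ W P y z := sup { −octForm κ₂ r₁ W ∅ (δu) P y z : u τ-Lipschitz on the sites of the octahedron }`   (§2),
a number attached to the SIX VERTEX WEIGHTS alone: non-negative, finite (§2), zero on plateau octahedra at the certified scale (part B's certificate),
and — by the WEIGHTED FRAME IDENTITY of §3 (`octForm_frameW`: the form with ARBITRARY vertex weights is the explicit quadratic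
`⅛·Σ₁₂(W_p+W_q)e′² + (c(2ρ)/4)·Σ₃(W_a⁺+W_a⁻)D_a²` in the eighteen frame atoms) — the value of a 6-parameter family of 12×12 box-constrained quadratic
programmes ("e-space": `F = eᵀM(W)e`, `M(W) = diag((W_p+W_q)/4) − Σ_a (|c|/8)(W_a⁺+W_a⁻)σ_aσ_aᵀ`; `num/espace.py`, sanity `4e-16`).
★ (Δ) `OctDictQ` — the dictionary `−octDeficit ≤ octForm(β)` per clean framed octahedron — is PROVED at the designate (§5, `octDictQ_designate`).

## The node

  (K₁ᴴ)[`IsCubicFccImage 0.9605 0.977`] ⟸ (L)[exact class] ∧ (Δ) `OctDictQ` [PROVED, §5] ∧ **(Λ) `OctDefLedgerQ`** [exact class]      (glue §6, `octShellHQ_of_dictLedger`)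
  (Λ) ⟸ (Λ₂) weak duality [PROVED, §7] ∧ **(Λ₁) `OctCertLedgerQ`** [exact class]                                                    (glue §7, `octDefLedgerQ_of_certLedger`)

with the EXACT equilibrium class `cls₀ := IsCubicFccImage (a₀√2) (a₀√2)` supplied by the sharpened selection `cubicSelectExact_of_numerics` (§1: the
landed scale certificate pins `a = a₀√2` exactly; the window version of part C only recorded `a ∈ [0.9605, 0.977]`) and (L) transported to `cls₀` by
antitonicity (§1).  **(Λ) THE FIELD-FREE DEFICIT LEDGER**: for every reference of the exact class and all invariant `C, X, D_i` (NINE binders; no field, no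
cocycle, no seams, no quantisation, no small-strain hypothesis):
  `octDefShellL := Σ_{y ∈ motif} Σᶠ_{z : shell octahedron (y,z)} ⅙·octDeficit ≤ c_T·shellMassL + cχ·transMassL + c_H·pricedNearCountL`.
(Λ) is STRONGER than (K₁ᴴ) in logical strength (it bounds the octahedron-wise WORST case, fields decoupled) but lives in a strictly smaller language:
distance geometry of invariant sets on ONE lattice + one explicit convex function of six weights per octahedron.  Cone: `chargedEnergyGap_of_edgeSpaceDeficit_numerics`
(§6) = part E's cone with `hOSH` replaced by `hΛ` (and `hOL` kept verbatim).  §7 goes one level further: the box programme behind `octDeficit` has at most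
three negative directions, and its three-multiplier Lagrangian dual is EXACT on every fold pattern tested (`num/sdual.py`); (Λ₂) WEAK DUALITY
(`octDeficit ≤` any certificate value) is PROVED, and the residual leaf **(Λ₁) `OctCertLedgerQ`** is (Λ) with the deficit replaced by the best certificate
value — a statement about the weight field and explicit 18-variable quadratics only, no displacement anywhere.  Final cone:
`chargedEnergyGap_of_certLedger_numerics` (§7).

## Why (Λ) is typed at the EXACT scale, and the numerics behind it (pure python, `num/`, lens-3 g74)

The octahedron-wise ledger is SCALE-CRITICAL: its truth is governed by the plateau margin `κ₂ − |c(2ρ)|` (`0.034` at `ρ = a₀`, `0.002` at the window's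
low end `a = 0.9605`).  Worst global ratio `Σ deficit / budget` over all tested geometries (slabs in six lattice orientations incl. the comb-aligned [001]
hole layer, cubic point cores, hexagonal line cores, two-core unions, χ-folds of both signs, capped-`w` gaps, doubly-laminar `w×(1−f)` products; a-priori
strain `3/100`, `c_T = 1/6e7`, `cχ = 30c_T`): `0.21–0.23` at `a = a₀√2 ≈ 0.9713–0.9716` (slab, [001]-aligned fold on a hole layer, onset depth `δ′ ≈ 36`),
but `4.0` at `a = 0.9605` and `1.15` at `0.9659` (`num/rhowindow.py`) — so over part C's WINDOW class (Λ) would be FALSE, over the exact class it holds with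
margin `≈ 4.5` in every tested geometry (`num/foldglobal.py`, `foldgeo.py`, `chifold.py`, `lamridge.py`).  Single octahedra lose up to `21.9 c_T` (cubic point
core, depth 30) and the budget that pays is NON-LOCAL (borrowed from transition sites `≈ 10` units along the distance gradient: `num/lamglobal.py`,
`laminar.py`) — which is why NO octahedron-local or star-local certificate can close (K₁ᴴ) (lineage dead ends g71–g73) and why the natural split of (Λ)
into «laminar near-nullity with a per-octahedron allowance» ∧ «fold charging» is FALSE as a local statement (tested: `w×(1−f)` products at the
χ-complement onset carry `0.3·(local c_T-budget) + 0.5·(local cχ-budget)` per octahedron; and an «affine-residual» local majorant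
`octDeficit ≤ L·(non-affinity − θ·min W)₊` is FALSE too: affine weight patterns of per-axis slope `> 0.33·W̄` already have a deficit, `num/affine.py`).
The split beneath (Λ) is therefore a TRANSPORT statement along the gradient lines of the distance functions, and its mechanism is identified (MEMO-g74 §6,
door [SEMICONCAVE], pre-registered for g75): `d_C` is semiconcave off `C`, so the total fold strength `∫|D²d_C|` over a shell region is bounded by
`2(n−1)·vol/d_min + area(∂)` (divergence theorem) — fold deficit `≲ 3.5e-5·w·|jump|` per octahedron against `c_T·χ` per transition SITE over a shell of
thickness `≈ 40 ≪ d_min = 80` reproduces the measured margin `≈ 4`.  Decidability aid [TAME]: `M(W)` is LINEAR in the six weights, so the PSD-safe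
weight set `{W : octDeficit = 0}` is CONVEX and every nullity lemma is a finite VERTEX check (calibrated in `num/affine.py`; the safe polytope at the true
margin `κ₂ − |c(2a₀)| ≈ 0.030–0.037` is `|slope| ≲ 0.15·W̄, non-affinity ≲ 0.03·W̄`).  Support leaf [A0⁺] `0.970 ≤ a₀√2` (sharper `Z6` tail) is
pre-registered with it: provers of (Λ) need `κ₂ − |c(2a₀)| ≥ 0.029`.

Contents: §1 exact-scale selection + class transport · §2 the Lipschitz-box deficit (defs, finiteness, `0 ≤ octDeficit ≤ 81·216²/20000` at the designate)
· §3 the weighted frame identity (PROVED) · §4 the pieces (Δ), (Λ) and the functional `octDefShellL` · §5 ★ (Δ) PROVED at the designate · §6 glue + cone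
· §7 the split beneath (Λ): dual certificates, ★ (Λ₂) weak duality PROVED, (Λ₁) `OctCertLedgerQ`, glue PROVED, final cone.
No `sorry`, no new axioms, no instances.
-/

noncomputable section

open scoped Classical
open Literature.MathematicalPhysics.StatisticalMechanics Literature.Geometry.DiscreteGeometry
open Summit.AtomisticToContinuum.Crystallization.Theses.PricedLinkCensus
open Summit.AtomisticToContinuum.Crystallization.Theorems.ChargedEnergyGapNegative

namespace Summit.AtomisticToContinuum.Crystallization.Theorems.ChargedEnergyGapChartDial

/-! ## §1 Exact-scale class selection and class transport -/

section Exact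

/-- Cubic fcc images are MONOTONE in the window. -/
theorem isCubicFccImage_mono {alo ahi alo' ahi' : ℝ} (hlo : alo' ≤ alo) (hhi : ahi ≤ ahi') {S : Set E3}
    (h : IsCubicFccImage alo ahi S) : IsCubicFccImage alo' ahi' S := by
  obtain ⟨a, h, s, g, ha, hh, hH, hfcc, hg, hP⟩ := h
  exact ⟨a, h, s, g, ⟨hlo.trans ha.1, ha.2.trans hhi⟩, hh, hH, hfcc, hg, hP⟩

/-- The EXACT equilibrium class is inside part C's window class. -/
theorem isCubicFccImage_window_of_exact {S : Set E3}
    (h : IsCubicFccImage (Fcc.a0 * Real.sqrt 2) (Fcc.a0 * Real.sqrt 2) S) : IsCubicFccImage (1921 / 2000) (977 / 1000) S :=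
  isCubicFccImage_mono a0_sqrt2_cubic_window.1 a0_sqrt2_cubic_window.2 h

/-- ★ **(G) AT THE EXACT SCALE**: given `Fcc.FccStressFreeScale`, every site-stress-free fcc-class reference is a rigid copy of the cubic stacking at
nearest-neighbour distance EXACTLY `a₀√2` (part C recorded only the window; the proof is the same up to its last line). -/
theorem cubicSelectExact_of_fccStressFreeScale (hU : Fcc.FccStressFreeScale) :
    CubicSelect IsFccImage (IsCubicFccImage (Fcc.a0 * Real.sqrt 2) (Fcc.a0 * Real.sqrt 2)) := by
  intro P hI _hF hS
  obtain ⟨a, h, s, g, ha, hh, hH, hfcc, hg, hP⟩ := hI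
  obtain ⟨g₀, hg₀, hst⟩ := Fcc.exists_isometry_eq_image_fccStacking hH hfcc a h
  have hP₁ : P.points = (fun x => g (g₀ x)) '' fccStacking a h := by rw [hP, hst, Set.image_image]
  obtain ⟨hhO, hb⟩ := hU P a h (fun x => g (g₀ x)) ha hh (hg.comp hg₀) hP₁ hS
  have h2 : Real.sqrt 2 ^ 2 = 2 := Real.sq_sqrt (by norm_num)
  have haeq : a = Fcc.a0 * Real.sqrt 2 := by
    rw [← hb]; unfold Fcc.bOf; linear_combination (-(a / 2)) * h2
  refine ⟨a, h, s, g, ?_, ⟨hh.1, by rw [hhO, Fcc.hOf_sq]⟩, hH, hfcc, hg, hP⟩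
  rw [haeq]; exact ⟨le_rfl, le_rfl⟩

/-- ★ (G) at the exact scale from the census-form certificate `Fcc.FccScaleNumerics`. -/
theorem cubicSelectExact_of_numerics (hU : Fcc.FccScaleNumerics) :
    CubicSelect IsFccImage (IsCubicFccImage (Fcc.a0 * Real.sqrt 2) (Fcc.a0 * Real.sqrt 2)) :=
  cubicSelectExact_of_fccStressFreeScale (Fcc.fccStressFreeScale_of_numerics hU)

/-- NON-VACUITY of the exact class: the Lennard-Jones fcc equilibrium `fccRef a₀` is a cubic fcc image at nearest-neighbour distance exactly `a₀√2`. -/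
theorem isCubicFccImage_exact_fccRef_a0 :
    IsCubicFccImage (Fcc.a0 * Real.sqrt 2) (Fcc.a0 * Real.sqrt 2) (Fcc.fccRef Fcc.a0 Fcc.a0_pos).points := by
  have ha : 0 < Fcc.a0 * Real.sqrt 2 := mul_pos Fcc.a0_pos (Real.sqrt_pos.2 (by norm_num))
  have h := isCubicFccImage_fcc ⟨le_refl (Fcc.a0 * Real.sqrt 2), le_refl (Fcc.a0 * Real.sqrt 2)⟩ ha
  rwa [Fcc.fccRef_points_congr (Fcc.bOf_pos ha) Fcc.a0_pos (Fcc.bOf_self_mul_sqrt2 Fcc.a0)] at h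

variable {cls₁ cls₂ : Set E3 → Prop} {s lam ℓ μ₀ τ ϱ b₀ r_S b₁ ϱχ r₁ r₂ κ₂ ρlo ρhi : ℝ}

/-- (L) is ANTITONE in the class: a ledger over a larger class restricts to a smaller one. -/
theorem octLedgerQ_anti (hcl : ∀ S, cls₁ S → cls₂ S) (h : OctLedgerQ cls₂ s lam ℓ μ₀ τ ϱ b₀ r_S b₁ ϱχ r₁ r₂ κ₂ ρlo ρhi) :
    OctLedgerQ cls₁ s lam ℓ μ₀ τ ϱ b₀ r_S b₁ ϱχ r₁ r₂ κ₂ ρlo ρhi :=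
  fun P C X β₀ k S m D σ h1 h2 hc => h P C X β₀ k S m D σ h1 h2 (hcl _ hc)

/-- (L) over the window class gives (L) over the exact class. -/
theorem octLedgerQ_exact_of_window
    (h : OctLedgerQ (IsCubicFccImage (1921 / 2000) (977 / 1000)) s lam ℓ μ₀ τ ϱ b₀ r_S b₁ ϱχ r₁ r₂ κ₂ ρlo ρhi) :
    OctLedgerQ (IsCubicFccImage (Fcc.a0 * Real.sqrt 2) (Fcc.a0 * Real.sqrt 2)) s lam ℓ μ₀ τ ϱ b₀ r_S b₁ ϱχ r₁ r₂ κ₂ ρlo ρhi :=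
  octLedgerQ_anti (fun _ hS => isCubicFccImage_window_of_exact hS) h

end Exact

/-! ## §2 The Lipschitz-box deficit of an octahedron -/

section Deficit

variable {P : PeriodicConfiguration 3}

/-- ADMISSIBLE DISPLACEMENTS of the octahedron of `(y, z)`: `τ`-Lipschitz on its sites (exactly what `SmallStrain τ` + local exactness leave of the field). -/
def OctLip (P : PeriodicConfiguration 3) (r₁ τ : ℝ) (y z : E3) (u : E3 → E3) : Prop :=
  ∀ p q : E3, InOct P r₁ y z p → InOct P r₁ y z q → ‖u q - u p‖ ≤ τ * dist p q

/-- ★ **THE LIPSCHITZ-BOX DEFICIT** of the octahedron of `(y, z)` for the weight `W`: the supremum over admissible displacements `u` of minus the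
octahedron form of the coboundary `δu` (excision `∅`: on a clean octahedron the excision is invisible).  FIELD-FREE: a function of the six vertex
weights and the geometry of the octahedron.  `0` is admissible, so the deficit is `≥ 0` whenever the set is bounded (`octDeficit_nonneg`). -/
def octDeficit (κ₂ r₁ τ : ℝ) (W : E3 → ℝ) (P : PeriodicConfiguration 3) (y z : E3) : ℝ :=
  sSup ((fun u : E3 → E3 => -octForm κ₂ r₁ W ∅ (fun p q => u q - u p) P y z) '' {u | OctLip P r₁ τ y z u})

/-- The zero displacement is admissible (`0 ≤ τ`). -/
theorem octLip_zero {r₁ τ : ℝ} (hτ : 0 ≤ τ) (y z : E3) : OctLip P r₁ τ y z (fun _ => 0) := by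
  intro p q _ _
  rw [sub_self, norm_zero]
  exact mul_nonneg hτ dist_nonneg

/-- The octahedron form of the zero coboundary vanishes. -/
theorem octForm_cob_zero (κ₂ r₁ : ℝ) (W : E3 → ℝ) (X : Set E3) (P : PeriodicConfiguration 3) (y z : E3) :
    octForm κ₂ r₁ W X (fun p q => (fun _ : E3 => (0 : E3)) q - (fun _ : E3 => (0 : E3)) p) P y z = 0 := by
  have h0 : (fun p q : E3 => (fun _ : E3 => (0 : E3)) q - (fun _ : E3 => (0 : E3)) p) = fun _ _ => (0 : E3) := by
    funext p q; simp
  rw [h0]; exact octForm_zero κ₂ r₁ W X P y z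

/-- A coboundary pair term at the designate is `≥ −81/20000` once the displacement difference is `≤ 9/100` (weights in `[0, 1]`). -/
theorem octPairTerm_cob_lb {W : E3 → ℝ} (hW0 : ∀ x, 0 ≤ W x) (hW1 : ∀ x, W x ≤ 1) {u : E3 → E3} {p q : E3}
    (hβ : ‖u q - u p‖ ≤ 9 / 100) : -(81 / 20000) ≤ octPairTerm (1 / 2) (6 / 5) W ∅ (fun p q => u q - u p) p q := by
  unfold octPairTerm
  split_ifs with h
  · have hpe : pairElong (fun p q => u q - u p) p q ^ 2 ≤ 81 / 10000 :=
      (pairElong_sq_le (fun p q => u q - u p) p q).trans (by nlinarith [norm_nonneg (u q - u p)])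
    have hc : -(1 / 2) ≤ octCoef (1 / 2) (6 / 5) p q := octCoef_lb p q
    have hpe0 : 0 ≤ pairElong (fun p q => u q - u p) p q ^ 2 := sq_nonneg _
    have h1 : -(81 / 20000) ≤ octCoef (1 / 2) (6 / 5) p q * pairElong (fun p q => u q - u p) p q ^ 2 := by nlinarith
    have h2 : 0 ≤ W p * (octCoef (1 / 2) (6 / 5) p q * pairElong (fun p q => u q - u p) p q ^ 2 + 81 / 20000) :=
      mul_nonneg (hW0 p) (by linarith)
    nlinarith [hW1 p, hW0 p]
  · norm_num

/-- ★ The octahedron form of an admissible coboundary at the designate is `≥ −(81/20000)·216²` (mid pair, separated reference, weights in `[0,1]`). -/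
theorem octForm_cob_lb (h1 : IsSeparatedRef (3 / 5) P) {W : E3 → ℝ} (hW0 : ∀ x, 0 ≤ W x) (hW1 : ∀ x, W x ≤ 1) {u : E3 → E3} {y z : E3}
    (hu : OctLip P (6 / 5) (3 / 100) y z u) (hyz : dist y z ≤ 3 / 2) :
    -(81 / 20000 * 216 ^ 2) ≤ octForm (1 / 2) (6 / 5) W ∅ (fun p q => u q - u p) P y z := by
  classical
  have hF := h1.finite_inter_closedBall (by norm_num) y (3 / 2)
  set T : Finset E3 := hF.toFinset with hT
  have hmemT : ∀ x, InOct P (6 / 5) y z x → x ∈ T := fun x hx => by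
    rw [hT, Set.Finite.mem_toFinset]
    exact ⟨(hx.dist_le hyz).1, Metric.mem_closedBall.2 (hx.dist_le hyz).2⟩
  have hTmem : ∀ p ∈ T, p ∈ P.points ∧ dist p y ≤ 3 / 2 := fun p hp => by
    rw [hT, Set.Finite.mem_toFinset] at hp; exact ⟨hp.1, Metric.mem_closedBall.1 hp.2⟩
  have hcard : (T.card : ℝ) ≤ 216 := card_near_le h1 y T hTmem
  unfold octForm
  have inner_eq : ∀ p : E3, (∑ᶠ q : E3, if InOct P (6 / 5) y z p ∧ InOct P (6 / 5) y z q then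
      octPairTerm (1 / 2) (6 / 5) W ∅ (fun p q => u q - u p) p q else 0) =
      ∑ q ∈ T, if InOct P (6 / 5) y z p ∧ InOct P (6 / 5) y z q then octPairTerm (1 / 2) (6 / 5) W ∅ (fun p q => u q - u p) p q else 0 := by
    intro p
    apply finsum_eq_sum_of_support_subset
    intro q hq
    by_contra hqV
    exact (Function.mem_support.1 hq) (if_neg fun h' => hqV (hmemT q h'.2))
  simp_rw [inner_eq]
  rw [finsum_eq_sum_of_support_subset (s := T)]
  · have hterm : ∀ p ∈ T, ∀ q ∈ T, -(81 / 20000 : ℝ) ≤ (if InOct P (6 / 5) y z p ∧ InOct P (6 / 5) y z q then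
        octPairTerm (1 / 2) (6 / 5) W ∅ (fun p q => u q - u p) p q else 0) := by
      intro p hp q hq
      split_ifs with h
      · refine octPairTerm_cob_lb hW0 hW1 ?_
        have h3 := dist_triangle p y q
        rw [dist_comm y q] at h3
        have hd3 : dist p q ≤ 3 := by linarith [(hTmem p hp).2, (hTmem q hq).2]
        linarith [hu p q h.1 h.2]
      · norm_num
    have hc0 : (0 : ℝ) ≤ T.card := Nat.cast_nonneg _
    calc -(81 / 20000 * 216 ^ 2 : ℝ) ≤ ∑ p ∈ T, ∑ q ∈ T, (-(81 / 20000) : ℝ) := by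
          simp only [Finset.sum_const, nsmul_eq_mul]; nlinarith
      _ ≤ _ := Finset.sum_le_sum fun p hp => Finset.sum_le_sum fun q hq => hterm p hp q hq
  · intro p hp
    by_contra hpV
    exact (Function.mem_support.1 hp) (Finset.sum_eq_zero fun q _ => if_neg fun h' => hpV (hmemT p h'.1))

/-- The deficit set at the designate is bounded above … -/
theorem octDeficit_bddAbove (h1 : IsSeparatedRef (3 / 5) P) {W : E3 → ℝ} (hW0 : ∀ x, 0 ≤ W x) (hW1 : ∀ x, W x ≤ 1) {y z : E3}
    (hyz : dist y z ≤ 3 / 2) :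
    BddAbove ((fun u : E3 → E3 => -octForm (1 / 2) (6 / 5) W ∅ (fun p q => u q - u p) P y z) '' {u | OctLip P (6 / 5) (3 / 100) y z u}) := by
  refine ⟨81 / 20000 * 216 ^ 2, ?_⟩
  rintro _ ⟨u, hu, rfl⟩
  have := octForm_cob_lb h1 hW0 hW1 hu hyz
  linarith

/-- … so every admissible coboundary realises at most the deficit: `−octForm(δu) ≤ octDeficit`. -/
theorem neg_octForm_cob_le_octDeficit (h1 : IsSeparatedRef (3 / 5) P) {W : E3 → ℝ} (hW0 : ∀ x, 0 ≤ W x) (hW1 : ∀ x, W x ≤ 1)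
    {y z : E3} (hyz : dist y z ≤ 3 / 2) {u : E3 → E3} (hu : OctLip P (6 / 5) (3 / 100) y z u) :
    -octForm (1 / 2) (6 / 5) W ∅ (fun p q => u q - u p) P y z ≤ octDeficit (1 / 2) (6 / 5) (3 / 100) W P y z := by
  unfold octDeficit
  exact le_csSup (octDeficit_bddAbove h1 hW0 hW1 hyz) ⟨u, hu, rfl⟩

/-- ★ `0 ≤ octDeficit ≤ (81/20000)·216²` at the designate. -/
theorem octDeficit_nonneg (h1 : IsSeparatedRef (3 / 5) P) {W : E3 → ℝ} (hW0 : ∀ x, 0 ≤ W x) (hW1 : ∀ x, W x ≤ 1) {y z : E3}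
    (hyz : dist y z ≤ 3 / 2) : 0 ≤ octDeficit (1 / 2) (6 / 5) (3 / 100) W P y z := by
  have h := neg_octForm_cob_le_octDeficit h1 hW0 hW1 hyz (octLip_zero (by norm_num) y z)
  rwa [octForm_cob_zero, neg_zero] at h

/-- `octDeficit_le` (docstring added by the landing lane; see the module docstring). [formal bookkeeping] -/
theorem octDeficit_le (h1 : IsSeparatedRef (3 / 5) P) {W : E3 → ℝ} (hW0 : ∀ x, 0 ≤ W x) (hW1 : ∀ x, W x ≤ 1) {y z : E3}
    (hyz : dist y z ≤ 3 / 2) : octDeficit (1 / 2) (6 / 5) (3 / 100) W P y z ≤ 81 / 20000 * 216 ^ 2 := by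
  unfold octDeficit
  refine csSup_le ⟨_, ⟨fun _ => 0, octLip_zero (by norm_num) y z, rfl⟩⟩ ?_
  rintro _ ⟨u, hu, rfl⟩
  have := octForm_cob_lb h1 hW0 hW1 hu hyz
  linarith

end Deficit

/-! ## §3 The weighted frame identity (e-space form of the octahedron form with ARBITRARY vertex weights) -/

section FrameW

variable {P : PeriodicConfiguration 3} {c : E3} {f : Fin 3 → E3} {ρ r₁ : ℝ} {y z : E3}

/-- The WEIGHTED edge quadratic `Σ_{12 edges} (W_p + W_q)·e′²` (edges in the order of `octE`). -/
def octEW (Wv : Fin 3 × Bool → ℝ) (A : Fin 3 → Fin 3 × Bool → ℝ) : ℝ :=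
  (Wv (0, true) + Wv (1, true)) * ((A 1 (1, true) - A 1 (0, true)) - (A 0 (1, true) - A 0 (0, true))) ^ 2 +
  (Wv (0, true) + Wv (1, false)) * (-(A 1 (1, false) - A 1 (0, true)) - (A 0 (1, false) - A 0 (0, true))) ^ 2 +
  (Wv (0, true) + Wv (2, true)) * ((A 2 (2, true) - A 2 (0, true)) - (A 0 (2, true) - A 0 (0, true))) ^ 2 +
  (Wv (0, true) + Wv (2, false)) * (-(A 2 (2, false) - A 2 (0, true)) - (A 0 (2, false) - A 0 (0, true))) ^ 2 +
  (Wv (0, false) + Wv (1, true)) * ((A 1 (1, true) - A 1 (0, false)) + (A 0 (1, true) - A 0 (0, false))) ^ 2 +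
  (Wv (0, false) + Wv (1, false)) * (-(A 1 (1, false) - A 1 (0, false)) + (A 0 (1, false) - A 0 (0, false))) ^ 2 +
  (Wv (0, false) + Wv (2, true)) * ((A 2 (2, true) - A 2 (0, false)) + (A 0 (2, true) - A 0 (0, false))) ^ 2 +
  (Wv (0, false) + Wv (2, false)) * (-(A 2 (2, false) - A 2 (0, false)) + (A 0 (2, false) - A 0 (0, false))) ^ 2 +
  (Wv (1, true) + Wv (2, true)) * ((A 2 (2, true) - A 2 (1, true)) - (A 1 (2, true) - A 1 (1, true))) ^ 2 +
  (Wv (1, true) + Wv (2, false)) * (-(A 2 (2, false) - A 2 (1, true)) - (A 1 (2, false) - A 1 (1, true))) ^ 2 +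
  (Wv (1, false) + Wv (2, true)) * ((A 2 (2, true) - A 2 (1, false)) + (A 1 (2, true) - A 1 (1, false))) ^ 2 +
  (Wv (1, false) + Wv (2, false)) * (-(A 2 (2, false) - A 2 (1, false)) + (A 1 (2, false) - A 1 (1, false))) ^ 2

/-- The WEIGHTED diagonal quadratic `Σ_a (W_a⁺ + W_a⁻)·D_a²`. -/
def octDW (Wv : Fin 3 × Bool → ℝ) (A : Fin 3 → Fin 3 × Bool → ℝ) : ℝ :=
  (Wv (0, true) + Wv (0, false)) * (A 0 (0, true) - A 0 (0, false)) ^ 2 +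
  (Wv (1, true) + Wv (1, false)) * (A 1 (1, true) - A 1 (1, false)) ^ 2 +
  (Wv (2, true) + Wv (2, false)) * (A 2 (2, true) - A 2 (2, false)) ^ 2

/-- Consistency with part B: constant weights give `2W₀·octE`, `2W₀·octD`. -/
theorem octEW_const (W₀ : ℝ) (A : Fin 3 → Fin 3 × Bool → ℝ) : octEW (fun _ => W₀) A = 2 * W₀ * octE A := by
  unfold octEW octE; ring

/-- `octDW_const` (docstring added by the landing lane; see the module docstring). [formal bookkeeping] -/
theorem octDW_const (W₀ : ℝ) (A : Fin 3 → Fin 3 × Bool → ℝ) : octDW (fun _ => W₀) A = 2 * W₀ * octD A := by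
  unfold octDW octD; ring

/-- The value of one ordered pair term on a frame at `κ₂ = ½` with vertex weights `Wv`, in atoms (cf. `octTermVal`, the plateau case). -/
def octTermValW (A : Fin 3 → Fin 3 × Bool → ℝ) (cρ : ℝ) (Wv : Fin 3 × Bool → ℝ) (p q : Fin 3 × Bool) : ℝ :=
  if p = q then 0 else Wv p * (if p.1 = q.1 then (1 / 4) * cρ * (sgnB q.2 * (A p.1 q - A p.1 p)) ^ 2
    else (1 / 4) * ((sgnB q.2 * (A q.1 q - A q.1 p) - sgnB p.2 * (A p.1 q - A p.1 p)) ^ 2 / 2))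

/-- ★ The thirty-six weighted pair terms re-summed: `Σ_p Σ_q = ⅛·octEW + (c/4)·octDW` (each unordered edge `{p,q}` booked with `(W_p+W_q)/8·e′²`,
each diagonal with `(W_a⁺+W_a⁻)·c/4·D_a²`) — the e-SPACE FORM `eᵀM(W)e` of the numerics. -/
theorem octTermValW_sum (A : Fin 3 → Fin 3 × Bool → ℝ) (cρ : ℝ) (Wv : Fin 3 × Bool → ℝ) :
    ∑ p : Fin 3 × Bool, ∑ q : Fin 3 × Bool, octTermValW A cρ Wv p q = (1 / 8) * octEW Wv A + cρ / 4 * octDW Wv A := by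
  simp only [octTermValW, octEW, octDW, Fintype.sum_prod_type, Fin.sum_univ_three, Fintype.sum_bool, sgnB, Prod.mk.injEq,
    Fin.reduceEq, Fin.isValue, Bool.true_eq_false, Bool.false_eq_true, and_true, and_false, ↓reduceIte]
  ring

/-- Each pair term of the octahedron form on a CLEAN frame carrying a coboundary is the weighted atom value (no plateau hypothesis). -/
theorem octPairTerm_frameW (hf : Orthonormal ℝ f) (hρ : 0 < ρ) (W : E3 → ℝ) (X : Set E3) (β : E3 → E3 → E3) (u : E3 → E3)
    (hedge : ρ * Real.sqrt 2 ≤ r₁) (hdiag : r₁ < 2 * ρ) (hX : ∀ i b, octVertex c f ρ i b ∉ X)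
    (hu : ∀ i b j b', β (octVertex c f ρ i b) (octVertex c f ρ j b') = u (octVertex c f ρ j b') - u (octVertex c f ρ i b))
    (p q : Fin 3 × Bool) :
    octPairTerm (1 / 2) r₁ W X β (octVertex c f ρ p.1 p.2) (octVertex c f ρ q.1 q.2) =
      octTermValW (frameAtom c f ρ u) (ljD2 (2 * ρ) - ljD1 (2 * ρ) / (2 * ρ)) (fun p => W (octVertex c f ρ p.1 p.2)) p q := by
  have hinj := octVertex_injective (c := c) hf hρ.ne'
  obtain ⟨i, b⟩ := p
  obtain ⟨j, b'⟩ := q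
  dsimp only
  unfold octTermValW
  by_cases hpq : ((i, b) : Fin 3 × Bool) = (j, b')
  · obtain ⟨hij, hbb⟩ := Prod.mk.inj hpq
    subst hij; subst hbb
    rw [if_pos rfl]
    unfold octPairTerm
    rw [if_neg fun h => h.1 rfl]
  · rw [if_neg hpq]
    have hne : octVertex c f ρ i b ≠ octVertex c f ρ j b' := fun h => hpq (hinj h)
    unfold octPairTerm
    rw [if_pos ⟨hne, hX j b'⟩]
    dsimp only
    congr 1
    by_cases hij : i = j
    · subst hij
      have hbb : b ≠ b' := fun h => hpq (by rw [h])
      rw [if_pos rfl]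
      unfold octCoef pairElong
      rw [dist_octVertex_diag hf hρ.le i hbb, if_neg (not_le.2 hdiag), hu, unit_inner_diag hρ.ne' i hbb, inner_sub_right]
      simp only [frameAtom]
    · rw [if_neg hij]
      unfold octCoef pairElong
      rw [dist_octVertex_edge hf hρ.le hij, if_pos hedge, hu, unit_inner_edge hρ.ne' i j, inner_sub_right, inner_sub_right, div_pow,
        Real.sq_sqrt (by norm_num : (0:ℝ) ≤ 2)]
      simp only [frameAtom]
      ring

/-- ★★ **THE WEIGHTED FRAME IDENTITY**: on a clean framed octahedron carrying a coboundary `δu`, the octahedron form at `κ₂ = ½` with ARBITRARY vertex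
weights is the explicit quadratic `⅛·octEW + (c(2ρ)/4)·octDW` in the frame atoms of `u` — the dictionary behind `octDeficit` (a 6-parameter family of
quadratic forms in the twelve edge elongations). -/
theorem octForm_frameW (hf : Orthonormal ℝ f) (hρ : 0 < ρ) (W : E3 → ℝ) (X : Set E3) (β : E3 → E3 → E3) (u : E3 → E3)
    (hedge : ρ * Real.sqrt 2 ≤ r₁) (hdiag : r₁ < 2 * ρ) (hO : ∀ x : E3, InOct P r₁ y z x ↔ ∃ i b, x = octVertex c f ρ i b)
    (hX : ∀ i b, octVertex c f ρ i b ∉ X)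
    (hu : ∀ i b j b', β (octVertex c f ρ i b) (octVertex c f ρ j b') = u (octVertex c f ρ j b') - u (octVertex c f ρ i b)) :
    octForm (1 / 2) r₁ W X β P y z =
      (1 / 8) * octEW (fun p => W (octVertex c f ρ p.1 p.2)) (frameAtom c f ρ u) +
        (ljD2 (2 * ρ) - ljD1 (2 * ρ) / (2 * ρ)) / 4 * octDW (fun p => W (octVertex c f ρ p.1 p.2)) (frameAtom c f ρ u) := by
  rw [octForm_frame (1 / 2) W X β (octVertex_injective hf hρ.ne') hO]
  simp_rw [octPairTerm_frameW hf hρ W X β u hedge hdiag hX hu]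
  exact octTermValW_sum _ _ _

end FrameW

end Summit.AtomisticToContinuum.Crystallization.Theorems.ChargedEnergyGapChartDial
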